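import Literature.MathematicalPhysics.QuantumFieldTheory.Balaban1983to89.B7Prop1Explicit
import Literature.NumberTheory.LFunctions.PlateauMollifier
import Summits.QuantumFields.BalabanUV.T4Continuum.Support.NE7PairProfiles
import HarnessLib

/-!
# NE7PairProfilesSharp — THE LATTICE GEOMETRY OF THE GLUING, SHARP FORM (F319b): the core profile with its EXACT support window
# `−3M < 4(x_i − Mζ_i) < 3M − 2` and the nearest parity block with HALF-OPEN uniqueness (`−M ≤ x_i − Mζ_i < M ⟹ ζ_c(x) = ζ`)

Cell `pub-balaban`, sub-cell t4, lineage `b2b-balaban-t4-ne7-p1` (CRUX PROVER NE7 #1 = OWNER of row NE7), gen 94; memo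
`t4/b2b-balaban-t4-ne7-p1-g94/PAIR-REP-ROAD.md` §5.  Sharpening of F319 `NE7PairProfiles` needed by the colour step (F320): a bond with one endpoint in the support
of `φ ζ` has BOTH endpoints in the half-open window `[−M, M)` of `ζ` for every `M ≥ 2` (so the parity-block map returns `ζ` at both endpoints), which the cruder
window `4|t| < 3M` of F319 does not give for `M ≤ 4`.  Same explicit lambdas as F319 (product of one-dimensional clamps; `c_i + 2⌊(x_i − Mc_i + M)∕2M⌋`).
WHAT ([folklore]; 0 def, 0 sorry): `exists_coreProfile_sharp`, `exists_parityBlock_sharp`, `abs_le_of_window` (the window lemmas themselves are in F320 `NE7PairColourStep`).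
HONEST FRAMING: lattice bookkeeping; nothing of Bałaban's asserted; hleaves NOT discharged; NE7 NOT PROVED; spine 0∕9; finite T⁴ rung (B)+1 — NOT infinite volume, NOT
mass gap, NOT `BetaPertH`, NOT Clay.  Axioms ⊆ {propext, Classical.choice, Quot.sound}.
-/

set_option autoImplicit false

open scoped BigOperators

namespace Summit.QuantumFields.BalabanUV.T4Continuum.NE7PairProfilesSharp

open Literature.MathematicalPhysics.QuantumFieldTheory.Balaban1983to89
open B7Prop1Explicit

noncomputable section

variable {d : ℕ}

open NE7PairProfiles (clamp_eq_one_iff clamp_pos_iff prod_mem_unit abs_prod_sub_prod_le)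

/-! ## §1 The sharp core profile -/

/-- **THE CORE PROFILE**: for `M ≥ 1` there is `φ : Site d → Site d → ℝ` (block index, site) with values in `[0,1]`, EQUAL TO `1` on the core
`{x : −M ≤ 2(x_i − Mζ_i) ≤ M − 1 ∀ i}`, POSITIVE only where `4|x_i − Mζ_i| < 3M` for all `i`, `4∕M`-LIPSCHITZ along every bond, and TRANSLATION COVARIANT
`φ (ζ + w) (x + M•w) = φ ζ x`. [folklore] -/
theorem exists_coreProfile_sharp {M : ℕ} (hM : 1 ≤ M) :
    ∃ φ : Site d → Site d → ℝ,
      (∀ ζ x, 0 ≤ φ ζ x ∧ φ ζ x ≤ 1) ∧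
      (∀ ζ x, (∀ i, -(M : ℤ) ≤ 2 * (x i - (M : ℤ) * ζ i) ∧ 2 * (x i - (M : ℤ) * ζ i) ≤ (M : ℤ) - 1) → φ ζ x = 1) ∧
      (∀ ζ x, 0 < φ ζ x → ∀ i, -(3 * (M : ℤ)) < 4 * (x i - (M : ℤ) * ζ i) ∧ 4 * (x i - (M : ℤ) * ζ i) < 3 * (M : ℤ) - 2) ∧
      (∀ (ζ x : Site d) (μ : Fin d), |φ ζ x - φ ζ (x + e μ)| ≤ 4 / (M : ℝ)) ∧
      (∀ ζ w x, φ (ζ + w) (x + (M : ℤ) • w) = φ ζ x) := by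
  have hM0 : (0 : ℝ) < M := by exact_mod_cast hM
  -- the one-dimensional clamp of the offset `t`
  let ψ : ℤ → ℝ := fun t => max 0 (min 1 (1 + 2 * min (2 * (t : ℝ) + M) ((M : ℝ) - 1 - 2 * t) / M))
  have hψ01 : ∀ t, 0 ≤ ψ t ∧ ψ t ≤ 1 := fun t => ⟨le_max_left _ _, max_le zero_le_one (min_le_left _ _)⟩
  have hψ1 : ∀ t : ℤ, -(M : ℤ) ≤ 2 * t → 2 * t ≤ (M : ℤ) - 1 → ψ t = 1 := by
    intro t h1 h2
    show max 0 (min 1 _) = 1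
    rw [clamp_eq_one_iff]
    have h1' : -(M : ℝ) ≤ 2 * t := by exact_mod_cast h1
    have h2' : 2 * (t : ℝ) ≤ (M : ℝ) - 1 := by exact_mod_cast h2
    have hmin : 0 ≤ min (2 * (t : ℝ) + M) ((M : ℝ) - 1 - 2 * t) := le_min (by linarith) (by linarith)
    have : 0 ≤ 2 * min (2 * (t : ℝ) + M) ((M : ℝ) - 1 - 2 * t) / M := by positivity
    linarith
  have hψpos : ∀ t : ℤ, 0 < ψ t → -(3 * (M : ℤ)) < 4 * t ∧ 4 * t < 3 * (M : ℤ) - 2 := by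
    intro t h
    have h' : 0 < 1 + 2 * min (2 * (t : ℝ) + M) ((M : ℝ) - 1 - 2 * t) / M := (clamp_pos_iff _).mp h
    have hmin : -(M : ℝ) / 2 < min (2 * (t : ℝ) + M) ((M : ℝ) - 1 - 2 * t) := by
      by_contra hc; push Not at hc
      have : 2 * min (2 * (t : ℝ) + M) ((M : ℝ) - 1 - 2 * t) / M ≤ 2 * (-(M : ℝ) / 2) / M :=
        div_le_div_of_nonneg_right (by linarith) hM0.le
      have h2 : 2 * (-(M : ℝ) / 2) / M = -1 := by field_simp
      linarith
    have ha : -(M : ℝ) / 2 < 2 * (t : ℝ) + M := hmin.trans_le (min_le_left _ _)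
    have hb : -(M : ℝ) / 2 < (M : ℝ) - 1 - 2 * t := hmin.trans_le (min_le_right _ _)
    constructor
    · have h5 : ((-(3 * (M : ℤ)) : ℤ) : ℝ) < ((4 * t : ℤ) : ℝ) := by push_cast; linarith
      exact_mod_cast h5
    · have h5 : ((4 * t : ℤ) : ℝ) < ((3 * (M : ℤ) - 2 : ℤ) : ℝ) := by push_cast; linarith
      exact_mod_cast h5
  have hψlip : ∀ t : ℤ, |ψ t - ψ (t + 1)| ≤ 4 / (M : ℝ) := by
    intro t
    refine (Literature.NumberTheory.LFunctions.PlateauMollifier.abs_clamp_sub_clamp_le _ _).trans ?_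
    have hid : (1 + 2 * min (2 * (t : ℝ) + M) ((M : ℝ) - 1 - 2 * t) / M) - (1 + 2 * min (2 * ((t + 1 : ℤ) : ℝ) + M) ((M : ℝ) - 1 - 2 * ((t + 1 : ℤ) : ℝ)) / M)
        = (2 / M) * (min (2 * (t : ℝ) + M) ((M : ℝ) - 1 - 2 * t) - min (2 * ((t + 1 : ℤ) : ℝ) + M) ((M : ℝ) - 1 - 2 * ((t + 1 : ℤ) : ℝ))) := by ring
    rw [hid, abs_mul, abs_of_pos (by positivity : (0 : ℝ) < 2 / M)]
    have hm : |min (2 * (t : ℝ) + M) ((M : ℝ) - 1 - 2 * t) - min (2 * ((t + 1 : ℤ) : ℝ) + M) ((M : ℝ) - 1 - 2 * ((t + 1 : ℤ) : ℝ))| ≤ 2 := by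
      refine (abs_min_sub_min_le_max _ _ _ _).trans ?_
      push_cast
      refine max_le ?_ ?_
      · rw [show 2 * (t : ℝ) + M - (2 * (t + 1) + M) = -2 by ring]; norm_num
      · rw [show (M : ℝ) - 1 - 2 * t - ((M : ℝ) - 1 - 2 * (t + 1)) = 2 by ring]; norm_num
    calc 2 / (M : ℝ) * _ ≤ 2 / (M : ℝ) * 2 := mul_le_mul_of_nonneg_left hm (by positivity)
      _ = 4 / M := by ring
  refine ⟨fun ζ x => ∏ i, ψ (x i - (M : ℤ) * ζ i), fun ζ x => prod_mem_unit fun i => hψ01 _, fun ζ x hx => ?_, fun ζ x hpos i => ?_,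
    fun ζ x μ => ?_, fun ζ w x => ?_⟩
  · exact Finset.prod_eq_one fun i _ => hψ1 _ (by linarith [(hx i).1]) (by linarith [(hx i).2])
  · -- a positive product of nonnegative factors has positive factors
    have hi : 0 < ψ (x i - (M : ℤ) * ζ i) := by
      rcases (hψ01 (x i - (M : ℤ) * ζ i)).1.lt_or_eq with h | h
      · exact h
      · exfalso
        have : ∏ j, ψ (x j - (M : ℤ) * ζ j) = 0 := Finset.prod_eq_zero (Finset.mem_univ i) h.symm
        linarith
    exact hψpos _ hi
  · -- only the factor `μ` moves, by one unit of offset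
    have h := abs_prod_sub_prod_le (a := fun i => ψ (x i - (M : ℤ) * ζ i)) (b := fun i => ψ ((x + e μ) i - (M : ℤ) * ζ i))
      (fun i => hψ01 _) μ (fun i hi => by simp [e_apply, hi])
    refine h.trans ?_
    have : (x + e μ) μ - (M : ℤ) * ζ μ = (x μ - (M : ℤ) * ζ μ) + 1 := by simp [e_apply]; ring
    rw [this]
    exact hψlip _
  · refine Finset.prod_congr rfl fun i _ => ?_
    simp only [Pi.add_apply, Pi.smul_apply, smul_eq_mul]
    ring_nf

/-! ## §4 The nearest block of a given parity -/

/-- **THE NEAREST PARITY-`c` BLOCK**: for `M ≥ 1` and a parity vector `c`, the map `ζ_c(x)_i = c_i + 2⌊(x_i − Mc_i + M)∕2M⌋` satisfies: `ζ_c(x) = c + 2w` for some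
`w`; its radius-`M` cube contains `x` (`|x_i − Mζ_c(x)_i| ≤ M`); it is the ONLY block of parity `c` within `3M∕4` of `x`
(`ζ = c + 2w′`, `4|x_i − Mζ_i| < 3M ∀ i ⟹ ζ_c(x) = ζ`); and `ζ_c(x + 2NM•e_i) = ζ_c(x) + 2N•e_i`. [folklore] -/
theorem exists_parityBlock_sharp {M : ℕ} (hM : 1 ≤ M) (c : Site d) :
    ∃ Z : Site d → Site d,
      (∀ x, ∃ w : Site d, Z x = c + (2 : ℤ) • w) ∧
      (∀ x i, |x i - (M : ℤ) * Z x i| ≤ (M : ℤ)) ∧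
      (∀ (x ζ w : Site d), ζ = c + (2 : ℤ) • w → (∀ i, -(M : ℤ) ≤ x i - (M : ℤ) * ζ i ∧ x i - (M : ℤ) * ζ i < (M : ℤ)) → Z x = ζ) ∧
      (∀ (x : Site d) (i : Fin d) (N : ℕ), Z (x + ((2 * N * M : ℕ) : ℤ) • e i) = Z x + ((2 * N : ℕ) : ℤ) • e i) := by
  have hM0 : (0 : ℤ) < M := by exact_mod_cast hM
  have h2M : (0 : ℤ) < 2 * (M : ℤ) := by linarith
  refine ⟨fun x i => c i + 2 * ((x i - (M : ℤ) * c i + M) / (2 * (M : ℤ))), fun x => ⟨fun i => (x i - (M : ℤ) * c i + M) / (2 * (M : ℤ)), ?_⟩,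
    fun x i => ?_, fun x ζ w hζ hx => ?_, fun x i N => ?_⟩
  · funext i; simp [Pi.add_apply]
  · have h1 := Int.emod_add_mul_ediv (x i - (M : ℤ) * c i + M) (2 * (M : ℤ))
    have h2 := Int.emod_nonneg (x i - (M : ℤ) * c i + M) h2M.ne'
    have h3 := Int.emod_lt_of_pos (x i - (M : ℤ) * c i + M) h2M
    rw [abs_le]; constructor <;> nlinarith
  · funext i
    have h1 := Int.emod_add_mul_ediv (x i - (M : ℤ) * c i + M) (2 * (M : ℤ))
    have h2 := Int.emod_nonneg (x i - (M : ℤ) * c i + M) h2M.ne'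
    have h3 := Int.emod_lt_of_pos (x i - (M : ℤ) * c i + M) h2M
    have hxi := hx i
    rw [hζ] at hxi ⊢
    simp only [Pi.add_apply, Pi.smul_apply, smul_eq_mul] at hxi ⊢
    obtain ⟨hxa, hxb⟩ := hxi
    -- both `q = ⌊…⌋` and `w i` are integers with `M·|2q − 2w_i| < 2M`
    set q := (x i - (M : ℤ) * c i + M) / (2 * (M : ℤ)) with hq
    have hlt : q - w i < 1 := by
      by_contra h; push Not at h; nlinarith
    have hgt : -1 < q - w i := by
      by_contra h; push Not at h; nlinarith
    have : q = w i := by omega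
    rw [this]
  · funext j
    simp only [Pi.add_apply, Pi.smul_apply, e_apply, smul_eq_mul]
    by_cases hj : j = i
    · subst hj
      simp only [if_true, mul_one]
      have : x j + ((2 * N * M : ℕ) : ℤ) - (M : ℤ) * c j + M = (x j - (M : ℤ) * c j + M) + (N : ℤ) * (2 * (M : ℤ)) := by push_cast; ring
      rw [this, Int.add_mul_ediv_right _ _ h2M.ne']
      push_cast; ring
    · simp [hj]

/-! ## §3 The window lies in the cube -/

/-- The half-open window lies in the closed cube: `−M ≤ t < M ⟹ |t| ≤ M`. [folklore] -/
theorem abs_le_of_window {M : ℕ} {t : ℤ} (h : -(M : ℤ) ≤ t ∧ t < (M : ℤ)) : |t| ≤ (M : ℤ) := by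
  rw [abs_le]; constructor <;> omega

end

end Summit.QuantumFields.BalabanUV.T4Continuum.NE7PairProfilesSharp
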